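import Summits.ResolutionOfSingularities.ResolutionOfSingularities.Theorems.EquisingularLiftEquisingularLiftNatRatLiftSaturatedData
import Mathlib
import HarnessLib

/-!
# [OURS · L1 W4.5(b) · EL♮(3)] T-RATLIFT-ALG, PART 4 — SPECIMENS: the smooth MONOMIAL RATIONAL CURVES
# `C_e = (s^e : s^{e-1}t : st^{e-1} : t^e) ⊂ ℙ³_k` (every degree `e ≥ 3`; `C_4` = the rational quartic of PLANNER-MEMO-g10-1 §1 C3a)
# satisfy the cofinite clause, hence carry saturated-lift data over every DVR
# (crux `EquisingularLiftNatThree` = stmt-ResolutionOfSingularities-20148; res-L1-w45b-plan-1 PLANNER-MEMO-g10-1 class C3a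
# «H double along a smooth RATIONAL QUARTIC Γ (non-ACM, h¹(I_Γ(1)) = 1)» — the first carriers beyond the `ci` / `det` rungs)

NOT a statement of any manuscript. Helper file of the chain res-L1-w45b (cell `res-hironaka`, rung L, slot W4.5(b));
OURS; AI-written, weaker than expert review; def-free, no `sorry`, standard axioms; filed
`--supports stmt-ResolutionOfSingularities-20148 --as helper` (counted 0, registers nothing). NON-VACUITY of the RatLift
supplier's hypotheses on the planner's own specimen and on an infinite family: `C_3` is the twisted cubic (determinantal), `C_4` the
rational quartic; for `e ≥ 4`, `C_e` is not linearly normal (`h⁰(𝒪_{ℙ³}(1)) = 4 < e + 1`), hence not arithmetically Cohen–Macaulay,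
hence neither a complete intersection nor determinantal — carriers that only the `rat` route reaches. All parametrisations are
written inline (no definition).

§1 The quartic `(s⁴, s³t, st³, t⁴)` (`s = X 0`, `t = X 1`):
* `quartic_isHomogeneous`; `monomial_fin_two_eq` (a monomial of `k[s,t]` is `s^{d 0} t^{d 1}`); `clause_fin_two_of_forall_exponent`
  (CLAUSE CHECK BY EXPONENTS for any family `f : σ → k[s,t]`: exhibit `s^a t^{em−a}` for each `a ≤ em` — the specimen hand's entry point);
* **`quartic_clause_two`** — the COFINITE CLAUSE IN DEGREE 2 by the nine factorisations `s⁸ = s⁴·s⁴, s⁷t = s⁴·s³t, s⁶t² = (s³t)²,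
  s⁵t³ = s⁴·st³, s⁴t⁴ = s⁴·t⁴, s³t⁵ = s³t·t⁴, s²t⁶ = (st³)², st⁷ = st³·t⁴, t⁸ = (t⁴)²` (in degree 1 it fails — `s²t²` is missing —
  which is exactly «not projectively normal in degree 1»); `quartic_clause` — all degrees `m ≥ 2` (part 2 `clause_of_le`);
* **`quartic_exists_saturatedLift`** — the saturated-lift data of part 3 over every DVR (`m₀ = 2`).
§2 The family `C_e`, `e ≥ 3`:
* `monomialCurve_isHomogeneous`; `aeval_X_pow_mul` (`aeval C_e (x₀^v x₁^u x₂^w x₃^z) = s^{ev+(e−1)u+w} t^{u+(e−1)w+ez}`);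
  `isHomogeneous_X_pow_mul`; `clause_exponents_case_one` / `clause_exponents_case_two` (ℕ bookkeeping);
* **`monomialCurve_clause`** — THE COFINITE CLAUSE for `C_e` in EVERY degree `m ≥ e − 2`: for `s^a t^b` (`a + b = em`) write
  `a = qe + ρ` (`ρ < e`); if `q + ρ ≤ m` use `x₀^q x₂^ρ x₃^{m−q−ρ}`, else `x₀^{q+1−(e−ρ)} x₁^{e−ρ} x₃^{m−q−1}` (possible exactly when
  `m ≥ e − 2`) — direct, no propagation;
* **`monomialCurve_exists_saturatedLift`** — saturated-lift data for every `C_e` over every DVR (`m₀ = e − 2`).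
The liftable-centre corollaries (composition with part 5 `isLiftableCentre_setOf_forms` and res-type-051's SatLift / T-RATREG) are in
the follow-up file `…RatLiftMonomialCurvesLiftable`.

References: folklore (the rational quartic: Hartshorne, *Algebraic Geometry*, I Ex. 3.18 / III Ex. 5.6 [Hartshorne1977]; monomial curves);
cell: PLANNER-MEMO-g10-1 (res-L1-w45b-plan-1; OURS, index only).
-/

set_option linter.dupNamespace false -- mandated namespace `Summit.<Summit>.<Problem>` of this single-conjunct summit

namespace Summit.ResolutionOfSingularities.ResolutionOfSingularities.Cruxes.EquisingularLiftNat.Sections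

namespace RatLift

open MvPolynomial

universe u v

section Quartic

variable (k : Type v) [CommRing k]

/-- The entries of the rational-quartic parametrisation `(s⁴, s³t, st³, t⁴)` are forms of degree `4`. [folklore] [OURS · L1 W4.5b] -/
theorem quartic_isHomogeneous :
    ∀ i, ((![X 0 ^ 4, X 0 ^ 3 * X 1, X 0 * X 1 ^ 3, X 1 ^ 4] : Fin 4 → MvPolynomial (Fin 2) k) i).IsHomogeneous 4 := by
  intro i
  fin_cases i
  · exact isHomogeneous_X_pow 0 4
  · simpa using (isHomogeneous_X_pow (R := k) (0 : Fin 2) 3).mul (isHomogeneous_X k (1 : Fin 2))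
  · simpa using (isHomogeneous_X k (0 : Fin 2)).mul (isHomogeneous_X_pow (R := k) (1 : Fin 2) 3)
  · exact isHomogeneous_X_pow 1 4

/-- A monomial of `k[s, t]` is `s^{d 0} t^{d 1}`. [folklore] [OURS · L1 W4.5b] -/
theorem monomial_fin_two_eq (d : Fin 2 →₀ ℕ) :
    (monomial d (1 : k) : MvPolynomial (Fin 2) k) = X 0 ^ (d 0) * X 1 ^ (d 1) := by
  rw [monomial_eq, C_1, one_mul, Finsupp.prod_fintype _ _ (fun i => by simp), Fin.prod_univ_two]

/-- **Clause check by exponents (parameters `ℙ¹`).** To verify the cofinite clause at degree `m` for ANY family `f` it suffices to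
produce, for each `a ≤ e m`, a form of degree `m` in the `f i` equal to `s^a t^{em−a}` — the form specimen hands use (`interval_cases a`).
[folklore] [OURS · L1 W4.5b] -/
theorem clause_fin_two_of_forall_exponent {σ : Type u} (f : σ → MvPolynomial (Fin 2) k) {e m : ℕ}
    (h : ∀ a, a ≤ e * m → (X 0 ^ a * X 1 ^ (e * m - a) : MvPolynomial (Fin 2) k) ∈
      (homogeneousSubmodule σ k m).map (aeval (R := k) f).toLinearMap) :
    homogeneousSubmodule (Fin 2) k (e * m) ≤ (homogeneousSubmodule σ k m).map (aeval (R := k) f).toLinearMap := by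
  classical
  apply homogeneousSubmodule_le_of_forall_monomial_mem
  intro d hd
  have hsum : d 0 + d 1 = e * m := by
    have h1 := Finsupp.degree_eq_sum d
    rw [hd, Fin.sum_univ_two] at h1
    exact h1.symm
  rw [monomial_fin_two_eq, show d 1 = e * m - d 0 by omega]
  exact h (d 0) (by omega)

/-- **THE COFINITE CLAUSE IN DEGREE 2 for the rational quartic**: every form of degree `8` in `s, t` is a quadratic form in
`s⁴, s³t, st³, t⁴`. (In degree 1 it fails: `s²t²` is not in the span.) [folklore] [OURS · L1 W4.5b] -/
theorem quartic_clause_two :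
    homogeneousSubmodule (Fin 2) k (4 * 2) ≤ (homogeneousSubmodule (Fin 4) k 2).map
      (aeval (R := k) (![X 0 ^ 4, X 0 ^ 3 * X 1, X 0 * X 1 ^ 3, X 1 ^ 4] : Fin 4 → MvPolynomial (Fin 2) k)).toLinearMap := by
  classical
  apply homogeneousSubmodule_le_of_forall_monomial_mem
  intro d hd
  have hsum : d 0 + d 1 = 8 := by
    have h1 := Finsupp.degree_eq_sum d
    rw [hd, Fin.sum_univ_two] at h1
    omega
  -- a product `x_a x_b` of two variables is a quadratic form mapping to `f a * f b`
  have key : ∀ a b : Fin 4,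
      (aeval (R := k) (![X 0 ^ 4, X 0 ^ 3 * X 1, X 0 * X 1 ^ 3, X 1 ^ 4] : Fin 4 → MvPolynomial (Fin 2) k)) (X a * X b) ∈
        (homogeneousSubmodule (Fin 4) k 2).map
          (aeval (R := k) (![X 0 ^ 4, X 0 ^ 3 * X 1, X 0 * X 1 ^ 3, X 1 ^ 4] : Fin 4 → MvPolynomial (Fin 2) k)).toLinearMap :=
    fun a b => Submodule.mem_map_of_mem ((isHomogeneous_X k a).mul (isHomogeneous_X k b))
  rw [monomial_fin_two_eq, show d 1 = 8 - d 0 by omega]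
  have h0 : d 0 ≤ 8 := by omega
  interval_cases (d 0)
  · convert key 3 3 using 1
    simp
    ring
  · convert key 2 3 using 1
    simp
    ring
  · convert key 2 2 using 1
    simp
    ring
  · convert key 1 3 using 1
    simp
    ring
  · convert key 0 3 using 1
    simp
  · convert key 0 2 using 1
    simp
    ring
  · convert key 1 1 using 1
    simp
    ring
  · convert key 0 1 using 1
    simp
    ring
  · convert key 0 0 using 1
    simp
    ring

/-- **The cofinite clause for the rational quartic in every degree `m ≥ 2`** (`clause_of_le`: `s⁴ = f 0`, `t⁴ = f 3`).
[folklore] [OURS · L1 W4.5b] -/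
theorem quartic_clause : ∀ m, 2 ≤ m →
    homogeneousSubmodule (Fin 2) k (4 * m) ≤ (homogeneousSubmodule (Fin 4) k m).map
      (aeval (R := k) (![X 0 ^ 4, X 0 ^ 3 * X 1, X 0 * X 1 ^ 3, X 1 ^ 4] : Fin 4 → MvPolynomial (Fin 2) k)).toLinearMap :=
  clause_of_le (![X 0 ^ 4, X 0 ^ 3 * X 1, X 0 * X 1 ^ 3, X 1 ^ 4] : Fin 4 → MvPolynomial (Fin 2) k)
    (X_pow_mem_map_of_eq (![X 0 ^ 4, X 0 ^ 3 * X 1, X 0 * X 1 ^ 3, X 1 ^ 4] : Fin 4 → MvPolynomial (Fin 2) k)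
      (j := 0) (i₀ := 0) rfl)
    (X_pow_mem_map_of_eq (![X 0 ^ 4, X 0 ^ 3 * X 1, X 0 * X 1 ^ 3, X 1 ^ 4] : Fin 4 → MvPolynomial (Fin 2) k)
      (j := 1) (i₀ := 3) rfl)
    (m₀ := 2) (by norm_num) (quartic_clause_two k)

end Quartic

section QuarticLift

variable {O : Type u} [CommRing O] [IsDomain O] [IsDiscreteValuationRing O] {k : Type v} [Field k]
  (π : O →+* k) (hπ : Function.Surjective π) (ϖ : O) (hϖ : Irreducible ϖ)

include hπ hϖ in
/-- **SATURATED-LIFT DATA FOR THE RATIONAL QUARTIC over every DVR.** With `𝔭 = ker (aeval (s⁴, s³t, st³, t⁴))` (the homogeneous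
ideal of the smooth rational quartic curve in `ℙ³_k`) and `m₀ = 2`: forms `Gt l ∈ O[x₀..x₃]_{D l}` spanning a `ϖ`-saturated ideal,
reducing into `𝔭`, with `x_i² · 𝔭 ≤ span (π Gt)` — the upstairs input of res-type-051's `SatLift.liftableCentre_of_saturatedLift`
for PLANNER-MEMO-g10-1's class-C3a carrier. [folklore] [OURS · L1 W4.5b] -/
theorem quartic_exists_saturatedLift :
    ∃ (c : ℕ) (Gt : Fin c → MvPolynomial (Fin 4) O) (D : Fin c → ℕ),
      (∀ l, Gt l ∈ homogeneousSubmodule (Fin 4) O (D l)) ∧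
      (∀ y, C ϖ * y ∈ Ideal.span (Set.range Gt) → y ∈ Ideal.span (Set.range Gt)) ∧
      (∀ l, MvPolynomial.map π (Gt l) ∈
        RingHom.ker (aeval (R := k) (![X 0 ^ 4, X 0 ^ 3 * X 1, X 0 * X 1 ^ 3, X 1 ^ 4] : Fin 4 → MvPolynomial (Fin 2) k))) ∧
      (∀ i, ∀ a ∈ RingHom.ker (aeval (R := k) (![X 0 ^ 4, X 0 ^ 3 * X 1, X 0 * X 1 ^ 3, X 1 ^ 4] : Fin 4 → MvPolynomial (Fin 2) k)),
        X i ^ 2 * a ∈ Ideal.span (Set.range fun l => MvPolynomial.map π (Gt l))) :=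
  exists_saturatedLift π hπ ϖ hϖ _ (by norm_num) (quartic_isHomogeneous k) (quartic_clause k)

end QuarticLift


section MonomialCurve

variable (k : Type v) [CommRing k]

/-- The entries of `C_e = (s^e, s^{e-1}t, st^{e-1}, t^e)` are forms of degree `e` (`e ≥ 1`). [folklore] [OURS · L1 W4.5b] -/
theorem monomialCurve_isHomogeneous {e : ℕ} (he : 1 ≤ e) :
    ∀ i, ((![X 0 ^ e, X 0 ^ (e - 1) * X 1, X 0 * X 1 ^ (e - 1), X 1 ^ e] : Fin 4 → MvPolynomial (Fin 2) k) i).IsHomogeneous e := by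
  intro i
  fin_cases i
  · exact isHomogeneous_X_pow 0 e
  · have h := (isHomogeneous_X_pow (R := k) (0 : Fin 2) (e - 1)).mul (isHomogeneous_X k (1 : Fin 2))
    rw [Nat.sub_add_cancel he] at h
    simpa using h
  · have h := (isHomogeneous_X k (0 : Fin 2)).mul (isHomogeneous_X_pow (R := k) (1 : Fin 2) (e - 1))
    rw [Nat.add_sub_cancel' he] at h
    simpa using h
  · exact isHomogeneous_X_pow 1 e

/-- Substituting `C_e` into a monomial `x₀^v x₁^u x₂^w x₃^z` gives the monomial `s^{ev + (e−1)u + w} t^{u + (e−1)w + ez}`. [folklore]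
[OURS · L1 W4.5b] -/
theorem aeval_X_pow_mul (e v u w z : ℕ) :
    aeval (R := k) (![X 0 ^ e, X 0 ^ (e - 1) * X 1, X 0 * X 1 ^ (e - 1), X 1 ^ e] : Fin 4 → MvPolynomial (Fin 2) k)
      (X 0 ^ v * X 1 ^ u * X 2 ^ w * X 3 ^ z) =
      X 0 ^ (e * v + (e - 1) * u + w) * X 1 ^ (u + (e - 1) * w + e * z) := by
  simp only [map_mul, map_pow, aeval_X]
  simp only [Matrix.cons_val_zero, Matrix.cons_val_one, Matrix.cons_val]
  ring

/-- `x₀^v x₁^u x₂^w x₃^z` is a form of degree `v + u + w + z`. [folklore] [OURS · L1 W4.5b] -/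
theorem isHomogeneous_X_pow_mul (v u w z : ℕ) :
    (X 0 ^ v * X 1 ^ u * X 2 ^ w * X 3 ^ z : MvPolynomial (Fin 4) k).IsHomogeneous (v + u + w + z) :=
  (((isHomogeneous_X_pow (R := k) (0 : Fin 4) v).mul (isHomogeneous_X_pow (R := k) (1 : Fin 4) u)).mul
    (isHomogeneous_X_pow (R := k) (2 : Fin 4) w)).mul (isHomogeneous_X_pow (R := k) (3 : Fin 4) z)

/-- Exponent bookkeeping, case `q + ρ ≤ m` (`a = eq + ρ`, `a + b = em`): the `t`-exponent of `x₀^q x₂^ρ x₃^{m−q−ρ}` is `b`.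
[folklore] [OURS · L1 W4.5b] -/
theorem clause_exponents_case_one {e m q ρ a b : ℕ} (he : 1 ≤ e) (hc : q + ρ ≤ m) (hsum : a + b = e * m)
    (ha : a = e * q + ρ) : 0 + (e - 1) * ρ + e * (m - q - ρ) = b := by
  obtain ⟨e', rfl⟩ : ∃ e', e = e' + 1 := ⟨e - 1, by omega⟩
  obtain ⟨z, rfl⟩ : ∃ z, m = q + ρ + z := ⟨m - q - ρ, by omega⟩
  have hz : q + ρ + z - q - ρ = z := by omega
  rw [hz, Nat.add_sub_cancel]
  have h1 : (e' + 1) * (q + ρ + z) = e' * q + e' * ρ + e' * z + q + ρ + z := by ring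
  have h2 : (e' + 1) * q = e' * q + q := by ring
  have h3 : (e' + 1) * z = e' * z + z := by ring
  rw [h1] at hsum
  rw [h2] at ha
  rw [h3]
  omega

/-- Exponent bookkeeping, case `m < q + ρ` with `e − 2 ≤ m`, `q < m`, `ρ < e` (`a = eq + ρ`, `a + b = em`): for `u = e − ρ`,
`v = q + 1 − u`, `z = m − q − 1` one has `v + u + 0 + z = m`, `s`-exponent `a`, `t`-exponent `b`. [folklore] [OURS · L1 W4.5b] -/
theorem clause_exponents_case_two {e m q ρ a b : ℕ} (hρ : ρ < e) (hm : e - 2 ≤ m) (hc : m < q + ρ) (hq : q < m)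
    (hsum : a + b = e * m) (ha : a = e * q + ρ) :
    (q + 1 - (e - ρ)) + (e - ρ) + 0 + (m - q - 1) = m ∧
      e * (q + 1 - (e - ρ)) + (e - 1) * (e - ρ) + 0 = a ∧
      (e - ρ) + (e - 1) * 0 + e * (m - q - 1) = b := by
  obtain ⟨u, rfl⟩ : ∃ u, e = ρ + u := ⟨e - ρ, by omega⟩
  have hu : ρ + u - ρ = u := by omega
  rw [hu]
  obtain ⟨v, hv⟩ : ∃ v, q + 1 = u + v := ⟨q + 1 - u, by omega⟩
  have hv' : q + 1 - u = v := by omega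
  rw [hv']
  obtain ⟨z, rfl⟩ : ∃ z, m = q + 1 + z := ⟨m - q - 1, by omega⟩
  have hz : q + 1 + z - q - 1 = z := by omega
  rw [hz]
  obtain ⟨u', rfl⟩ : ∃ u', u = u' + 1 := ⟨u - 1, by omega⟩
  have h0 : ρ + (u' + 1) - 1 = ρ + u' := by omega
  rw [h0]
  refine ⟨by omega, ?_, ?_⟩
  · -- e v + (e-1) u = e (q+1) - u = e q + ρ
    have h1 : (ρ + (u' + 1)) * v + (ρ + u') * (u' + 1) = (ρ + (u' + 1)) * (v + (u' + 1)) - (u' + 1) := by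
      have : (ρ + (u' + 1)) * (v + (u' + 1)) = (ρ + (u' + 1)) * v + (ρ + u') * (u' + 1) + (u' + 1) := by ring
      omega
    rw [add_zero, h1, show v + (u' + 1) = q + 1 by omega, ha]
    have h2 : (ρ + (u' + 1)) * (q + 1) = (ρ + (u' + 1)) * q + ρ + (u' + 1) := by ring
    rw [h2]
    omega
  · have h1 : (ρ + (u' + 1)) * (q + 1 + z) = (ρ + (u' + 1)) * q + (ρ + (u' + 1)) * z + ρ + (u' + 1) := by ring
    rw [h1] at hsum
    rw [mul_zero, add_zero, ha] at *
    omega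

/-- **THE COFINITE CLAUSE FOR THE MONOMIAL CURVE `C_e`, every degree `m ≥ e − 2`** (`e ≥ 3`): every monomial `s^a t^b` with
`a + b = e m` is a product of `m` entries of `C_e`. [folklore] [OURS · L1 W4.5b] -/
theorem monomialCurve_clause {e : ℕ} (he : 3 ≤ e) : ∀ m, e - 2 ≤ m →
    homogeneousSubmodule (Fin 2) k (e * m) ≤ (homogeneousSubmodule (Fin 4) k m).map
      (aeval (R := k) (![X 0 ^ e, X 0 ^ (e - 1) * X 1, X 0 * X 1 ^ (e - 1), X 1 ^ e] : Fin 4 → MvPolynomial (Fin 2) k)).toLinearMap := by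
  intro m hm
  classical
  apply homogeneousSubmodule_le_of_forall_monomial_mem
  intro d hd
  have hsum : d 0 + d 1 = e * m := by
    have h1 := Finsupp.degree_eq_sum d
    rw [hd, Fin.sum_univ_two] at h1
    exact h1.symm
  obtain ⟨q, ρ, hρ, ha⟩ : ∃ q ρ, ρ < e ∧ d 0 = e * q + ρ :=
    ⟨d 0 / e, d 0 % e, Nat.mod_lt _ (by omega), (Nat.div_add_mod (d 0) e).symm⟩
  have hqm : q ≤ m := by
    have h1 : e * q ≤ e * m := by omega
    exact Nat.le_of_mul_le_mul_left h1 (by omega)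
  rw [monomial_fin_two_eq]
  by_cases hc : q + ρ ≤ m
  · refine ⟨X 0 ^ q * X 1 ^ 0 * X 2 ^ ρ * X 3 ^ (m - q - ρ), ?_, ?_⟩
    · have h := isHomogeneous_X_pow_mul k q 0 ρ (m - q - ρ)
      rw [show q + 0 + ρ + (m - q - ρ) = m by omega] at h
      exact (mem_homogeneousSubmodule _ _).mpr h
    · rw [AlgHom.toLinearMap_apply, aeval_X_pow_mul, clause_exponents_case_one (by omega) hc hsum ha,
        mul_zero, add_zero, ← ha]
  · have hq : q < m := by
      rcases Nat.lt_or_ge q m with h | h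
      · exact h
      · exfalso
        have hqm' : q = m := le_antisymm hqm h
        subst hqm'
        omega
    obtain ⟨hdeg, hA, hB⟩ := clause_exponents_case_two hρ hm (by omega) hq hsum ha
    refine ⟨X 0 ^ (q + 1 - (e - ρ)) * X 1 ^ (e - ρ) * X 2 ^ 0 * X 3 ^ (m - q - 1), ?_, ?_⟩
    · have h := isHomogeneous_X_pow_mul k (q + 1 - (e - ρ)) (e - ρ) 0 (m - q - 1)
      rw [hdeg] at h
      exact (mem_homogeneousSubmodule _ _).mpr h
    · rw [AlgHom.toLinearMap_apply, aeval_X_pow_mul, hA, hB]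

end MonomialCurve

section MonomialCurveLiftData

variable {O : Type u} [CommRing O] [IsDomain O] [IsDiscreteValuationRing O] {k : Type v} [Field k]
  (π : O →+* k) (hπ : Function.Surjective π) (ϖ : O) (hϖ : Irreducible ϖ)

include hπ hϖ in
/-- **SATURATED-LIFT DATA FOR EVERY MONOMIAL CURVE `C_e` (`e ≥ 3`) over every DVR** (`m₀ = e − 2`): the upstairs input of res-type-051's
`SatLift.liftableCentre_of_saturatedLift` for `𝔭 = ker (aeval C_e)`. [folklore] [OURS · L1 W4.5b] -/
theorem monomialCurve_exists_saturatedLift {e : ℕ} (he : 3 ≤ e) :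
    ∃ (c : ℕ) (Gt : Fin c → MvPolynomial (Fin 4) O) (D : Fin c → ℕ),
      (∀ l, Gt l ∈ homogeneousSubmodule (Fin 4) O (D l)) ∧
      (∀ y, C ϖ * y ∈ Ideal.span (Set.range Gt) → y ∈ Ideal.span (Set.range Gt)) ∧
      (∀ l, MvPolynomial.map π (Gt l) ∈ RingHom.ker (aeval (R := k)
        (![X 0 ^ e, X 0 ^ (e - 1) * X 1, X 0 * X 1 ^ (e - 1), X 1 ^ e] : Fin 4 → MvPolynomial (Fin 2) k))) ∧
      (∀ i, ∀ a ∈ RingHom.ker (aeval (R := k)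
          (![X 0 ^ e, X 0 ^ (e - 1) * X 1, X 0 * X 1 ^ (e - 1), X 1 ^ e] : Fin 4 → MvPolynomial (Fin 2) k)),
        X i ^ (e - 2) * a ∈ Ideal.span (Set.range fun l => MvPolynomial.map π (Gt l))) :=
  exists_saturatedLift π hπ ϖ hϖ _ (by omega) (monomialCurve_isHomogeneous k (by omega)) (monomialCurve_clause k he)

end MonomialCurveLiftData

end RatLift

end Summit.ResolutionOfSingularities.ResolutionOfSingularities.Cruxes.EquisingularLiftNat.Sections
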